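import Literature.NumberTheory.GelbartRogawski1991.LocalDoubledDiagonalEigenlaw
import Literature.NumberTheory.GelbartRogawski1991.LocalDoubledDeltaFunctionalNondegenerate
import Literature.RepresentationTheory.TwistedCoinvariantsCompactIsotypic
import HarnessLib

/-!
# The doubling relation (D): the types of the two block restrictions of Kudla's CM splitting of the doubled group are DUAL
# — «types(s₂) = (χ_v ∘ det) · types(s₁)⁻¹»

Topic `NumberTheory/GelbartRogawski1991`; namespace `Literature.NumberTheory.GelbartRogawski1991.UnitaryDualPair.LocalSplitting`.  KERNEL ONLY:
theorems; no definition, no named fact, no `sorry`, no instance, no notation.  Cell `hodgecm-mathlib` (D-0151), fan B, L1ns road (P) of the crux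
hLiu418 — brick B3 = THE DOUBLING RELATION (D) (memo `F0/P6/B-p04/g44/MEMO-L1ns-road.v3.B-p04g44.md` §1); `--supports stmt-HodgeConjecture-24832`,
count-neutral.

SETTING (★ `LocalDoubledDiagonalEigenlaw`): a CM field `L ⊃ L⁺`, a finite place `v` of `L⁺`, Haar data `μ`, a symmetric invertible `T₀ ∈ M_n(L⁺)`,
`J = T₀ ⊗ 1`, `J′ = (−T₀) ⊗ 1`, a Hecke character `χ` with `IsSplittingChar L 1 χ`, Kudla's CM datum `D := localSplittingDatumCM L v μ n hT₀ hT₀d rfl χ hχ`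
of the doubled group `H = U(T₀ ⊕ −T₀)(L⁺_v)` with `s^𝔻 := D.localSplitting`, its two BLOCK RESTRICTIONS
`s₁ := BlockSum.restrictLeft … s^𝔻` (on `U(J)(L⁺_v)`, oscillator representation `ω₁` on `𝒮(L⁺_v^n)` for `T₀`) and
`s₂ := BlockSum.restrictRight … s^𝔻 ∘ toNegForm` (on the second copy `U(J′)(L⁺_v) = U(J)(L⁺_v)`, oscillator representation `ω₂` for `−T₀`),
an implementer `m₀` carrying `ℓ_Δ` onto `ℓ_Y` and the `Δ`-functional `λ(Φ) = (ω^𝔻(m₀) Φ)(0)`; the DIAGONAL SCALAR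
`e(g) := χ_v(det_Δ i(g,g))⁻¹ ∏_w ‖det_Δ i(g,g)_w‖^{1/2} = ∏_w χ_w(det g_w) · ∏_w ‖det g_w‖^{1/2}` (★ `chiDet_diagD`, `detDelta_diagD`).

* §1 (functional currency, no topology) **`exists_functional_right_of_eigenvector_left`**: if `f ≠ 0` is an eigenvector of `ω₁ ∘ s₁ ∘ φ` for a map
  `φ : A → U(J)(L⁺_v)` with eigenvalues `η : A → ℂ`, then `ℓ := λ(f ⊠ ·)` is a NON-ZERO functional on `𝒮(L⁺_v^n)` with
  `η(a) · ℓ(ω₂(s₂(φ a)) f₂) = e(φ a) · ℓ(f₂)` (★ `apply_zero_toRep_boxSB_restrict_diagD` + ★ `eq_zero_of_forall_apply_zero_toRep_boxSB_left_eq_zero`);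
  mirror **`exists_functional_left_of_eigenvector_right`**.
* §2 (coinvariant currency: `A` a COMPACT topological group, `φ : A →* U(J)(L⁺_v)`, characters `η θ : A →* ℂˣ` with `η · θ = e ∘ φ`, open kernels,
  `ω₁ ∘ s₁ ∘ φ` smooth) **`nontrivial_coinv_right_of_nontrivial_coinv_left`**: `Coinv_η(ω₁ ∘ s₁ ∘ φ) ≠ 0 ⟹ Coinv_θ(ω₂ ∘ s₂ ∘ φ) ≠ 0`
  (compact dictionary ★ `TwistedCoinv.exists_mem_weightSpace_mk_eq`, then §1 and ★ `TwistedCoinv.lift_eq_zero_iff`); mirror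
  **`nontrivial_coinv_left_of_nontrivial_coinv_right`**.  So for every compact abelian `A → U(J)(L⁺_v)` the TYPE SETS of the two blocks are
  exchanged by `η ↦ (e∘φ)·η⁻¹` — [Kudla1994, §3 Thm. 3.1] read through the doubling see-saw [HarrisKudlaSweet1996, §3]; for `A` = the centre and
  `n = 2` this is the relation `χ₀ ↦ μ_v²·χ₀⁻¹` between the vanishing characters of the two copies behind [Liu2021, App. D Lem. D.1 (1)].

HC_CM is NOT proved here and is proved only modulo the printed citations (2 remaining named inputs hLiu418, h413) until rung 0 closes.

## References
* [Kudla1994] S. Kudla, *Splitting metaplectic covers of dual reductive pairs*, Israel J. Math. 87 (1994), §2, §3 Thm. 3.1.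
* [HarrisKudlaSweet1996] M. Harris, S. Kudla, W. Sweet, *Theta dichotomy for unitary groups*, J. AMS 9 (1996), §1 (1.11)–(1.16), §3 (doubling see-saw).
* [MoeglinVignerasWaldspurger1987] C. Mœglin, M.-F. Vignéras, J.-L. Waldspurger, LNM 1291 (1987), Chap. 2 II.1 Rem. (6), II.2; Chap. 3 §IV.
* [BernsteinZelevinsky1976] I. N. Bernstein, A. V. Zelevinsky, Russian Math. Surveys 31 (1976), §2.1–2.3 (coinvariants of compact groups).
* [Liu2021] Y. Liu, Camb. J. Math. 9 (2021), App. D Lem. D.1 (1) (the consumer).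
-/

set_option autoImplicit false

noncomputable section

open scoped Matrix TensorProduct
open NumberField IsDedekindDomain MeasureTheory Matrix
open Literature.RepresentationTheory Literature.RepresentationTheory.HeisenbergGroup
open Literature.NumberTheory.Automorphic Literature.NumberTheory.Automorphic.UnitaryGroup
open Literature.NumberTheory.GaloisRepresentations Literature.RepresentationTheory.HarrisKudlaSweet1996

namespace Literature.NumberTheory.GelbartRogawski1991.UnitaryDualPair.LocalSplitting

variable (L : Type) [Field L] [NumberField L] [IsCMField L] (v : HeightOneSpectrum (𝓞 (maximalRealSubfield L)))
  [MeasurableSpace (v.adicCompletion (maximalRealSubfield L))] [BorelSpace (v.adicCompletion (maximalRealSubfield L))]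
  (μ : Measure (v.adicCompletion (maximalRealSubfield L))) [μ.IsAddHaarMeasure]
  (n : ℕ) {T₀ : Matrix (Fin n) (Fin n) (maximalRealSubfield L)} (hT₀ : T₀.IsSymm) (hT₀d : IsUnit T₀.det)
  (χ : HeckeCharacter L) (hχ : IsSplittingChar L 1 χ)
  (m₀ : LocalMp (maximalRealSubfield L) (n + n) (gramD (maximalRealSubfield L) n T₀) v)
  (hm₀ : (deltaLagrangian (maximalRealSubfield L) v n).map (toLin (maximalRealSubfield L) v (MpPsi.proj _ m₀)) =
    lagrangianY (maximalRealSubfield L) (n + n) v)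
  {J : Matrix (Fin n) (Fin n) L} (hJ : J = T₀.map (algebraMap (maximalRealSubfield L) L))
  {J' : Matrix (Fin n) (Fin n) L} (hJ' : J' = (-T₀).map (algebraMap (maximalRealSubfield L) L))

/-! ## §1 Functional currency: an eigenvector of one block gives a non-zero quasi-invariant functional of the other -/

section Functional

variable {A : Type*}

include hm₀ in
set_option maxHeartbeats 4000000 in -- the doubled CM datum's telescope (as in ★ `LocalDoubledDiagonalEigenlaw`)
/-- **(D), LEFT ⇒ RIGHT, FUNCTIONAL FORM.**  If `f ≠ 0` satisfies `ω₁(s₁(φ a)) f = η(a) • f` for all `a`, then the functional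
`ℓ(f₂) := (ω^𝔻(m₀)(f ⊠ f₂))(0)` on the second block is non-zero and `η(a) · ℓ(ω₂(s₂(φ a)) f₂) = e(φ a) · ℓ(f₂)`.
[cite: Kudla1994, §3 Thm. 3.1] [cite: HarrisKudlaSweet1996, §3] [cite: MoeglinVignerasWaldspurger1987, Chap. 2 II.1 Rem. (6)] -/
theorem exists_functional_right_of_eigenvector_left (φ : A → localPi L (IsCMField.complexConj L) n J v) (η : A → ℂ)
    {f : SchwartzBruhat (Fin n → v.adicCompletion (maximalRealSubfield L))} (hf0 : f ≠ 0)
    (hf : ∀ a, MpPsi.toRep (localSchrodinger (maximalRealSubfield L) n T₀ v)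
      (BlockSum.restrictLeft (maximalRealSubfield L) L (IsCMField.complexConj L) v n n hJ
        (hJD_finSum (maximalRealSubfield L) L n rfl) (complexConj_imagUnit L) (imagUnit_ne_zero L) (imagUnit_mul_self L)
        hT₀ hT₀.neg (isUnit_det_neg_of_isUnit (maximalRealSubfield L) n hT₀d)
        ((localSplittingDatumCM L v μ n hT₀ hT₀d rfl χ hχ).localSplitting)
        ((localSplittingDatumCM L v μ n hT₀ hT₀d rfl χ hχ).proj_localSplitting) (φ a)) f = η a • f) :
    ∃ ℓ : SchwartzBruhat (Fin n → v.adicCompletion (maximalRealSubfield L)) →ₗ[ℂ] ℂ, ℓ ≠ 0 ∧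
      (∀ f₂, ℓ f₂ = ((MpPsi.toRep (localSchrodinger (maximalRealSubfield L) (n + n) (gramD (maximalRealSubfield L) n T₀) v) m₀
          (boxSB (v.adicCompletion (maximalRealSubfield L)) (e₂ n) f f₂) :
        SchwartzBruhat (Fin (n + n) → v.adicCompletion (maximalRealSubfield L))) : (Fin (n + n) → v.adicCompletion (maximalRealSubfield L)) → ℂ) 0) ∧
      ∀ (a : A) (f₂ : SchwartzBruhat (Fin n → v.adicCompletion (maximalRealSubfield L))),
        η a * ℓ (MpPsi.toRep (localSchrodinger (maximalRealSubfield L) n (-T₀) v)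
          (BlockSum.restrictRight (maximalRealSubfield L) L (IsCMField.complexConj L) v n n hJ'
            (hJD_finSum (maximalRealSubfield L) L n rfl) (complexConj_imagUnit L) (imagUnit_ne_zero L) (imagUnit_mul_self L)
            hT₀ hT₀.neg hT₀d
            ((localSplittingDatumCM L v μ n hT₀ hT₀d rfl χ hχ).localSplitting)
            ((localSplittingDatumCM L v μ n hT₀ hT₀d rfl χ hχ).proj_localSplitting)
            (toNegForm (maximalRealSubfield L) L (IsCMField.complexConj L) v n hJ hJ' (φ a))) f₂) =
        (((chiDet (maximalRealSubfield L) L (IsCMField.complexConj L) v n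
            (fun w' : PlacesOver L v => (χ.localComponent w'.1)⁻¹)
            (diagD (maximalRealSubfield L) L (IsCMField.complexConj L) v n hJ hJ' rfl (φ a)))⁻¹ : ℂˣ) : ℂ) *
        ((∏ w' : PlacesOver L v,
            Real.sqrt ‖detDelta (maximalRealSubfield L) L (IsCMField.complexConj L) v n w'
              (diagD (maximalRealSubfield L) L (IsCMField.complexConj L) v n hJ hJ' rfl (φ a))‖ : ℝ) : ℂ) * ℓ f₂ := by
  -- the slice functional `ℓ = λ(f ⊠ ·)`
  obtain ⟨lam, hlam⟩ := exists_linearMap_apply_zero_toRep (maximalRealSubfield L) v n m₀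
  let ℓ : SchwartzBruhat (Fin n → v.adicCompletion (maximalRealSubfield L)) →ₗ[ℂ] ℂ :=
    lam ∘ₗ (sumEquivSB (v.adicCompletion (maximalRealSubfield L)) (e₂ n)).toLinearMap ∘ₗ
      TensorProduct.mk ℂ (SchwartzBruhat (Fin n → v.adicCompletion (maximalRealSubfield L)))
        (SchwartzBruhat (Fin n → v.adicCompletion (maximalRealSubfield L))) f
  have hℓ' : ∀ f₂, ℓ f₂ = lam (boxSB (v.adicCompletion (maximalRealSubfield L)) (e₂ n) f f₂) := by
    intro f₂
    change lam (sumEquivSB (v.adicCompletion (maximalRealSubfield L)) (e₂ n) (f ⊗ₜ f₂)) = _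
    rw [sumEquivSB_tmul]
  have hℓ : ∀ f₂, ℓ f₂ = ((MpPsi.toRep (localSchrodinger (maximalRealSubfield L) (n + n) (gramD (maximalRealSubfield L) n T₀) v) m₀
          (boxSB (v.adicCompletion (maximalRealSubfield L)) (e₂ n) f f₂) :
        SchwartzBruhat (Fin (n + n) → v.adicCompletion (maximalRealSubfield L))) : (Fin (n + n) → v.adicCompletion (maximalRealSubfield L)) → ℂ) 0 :=
    fun f₂ => (hℓ' f₂).trans (hlam _)
  -- `(c • f) ⊠ g = c • (f ⊠ g)`
  have hsmul : ∀ (c : ℂ) (g : SchwartzBruhat (Fin n → v.adicCompletion (maximalRealSubfield L))),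
      boxSB (v.adicCompletion (maximalRealSubfield L)) (e₂ n) (c • f) g = c • boxSB (v.adicCompletion (maximalRealSubfield L)) (e₂ n) f g := by
    intro c g
    rw [← sumEquivSB_tmul, ← TensorProduct.smul_tmul', map_smul, sumEquivSB_tmul]
  refine ⟨ℓ, ?_, hℓ, ?_⟩
  · -- non-degeneracy: `ℓ = 0` would force `f = 0`
    intro h0
    apply hf0
    refine eq_zero_of_forall_apply_zero_toRep_boxSB_left_eq_zero (maximalRealSubfield L) v n hT₀d m₀ hm₀ f fun f₂ => ?_
    rw [← hℓ, h0, LinearMap.zero_apply]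
  · -- the diagonal eigen-law on `f ⊠ f₂`, with `ω₁(s₁(φ a)) f = η a • f`
    intro a f₂
    have key := apply_zero_toRep_boxSB_restrict_diagD L v μ n hT₀ hT₀d χ hχ m₀ hm₀ hJ hJ' (φ a) f f₂
    rw [← hlam, ← hlam, hf a, hsmul, map_smul, smul_eq_mul] at key
    rw [hℓ', hℓ']
    exact key

include hm₀ in
set_option maxHeartbeats 4000000 in -- the doubled CM datum's telescope (as in ★ `LocalDoubledDiagonalEigenlaw`)
/-- **(D), RIGHT ⇒ LEFT, FUNCTIONAL FORM.**  If `f₂ ≠ 0` satisfies `ω₂(s₂(φ a)) f₂ = η(a) • f₂` for all `a`, then the functional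
`ℓ′(f₁) := (ω^𝔻(m₀)(f₁ ⊠ f₂))(0)` on the first block is non-zero and `η(a) · ℓ′(ω₁(s₁(φ a)) f₁) = e(φ a) · ℓ′(f₁)`.
[cite: Kudla1994, §3 Thm. 3.1] [cite: HarrisKudlaSweet1996, §3] [cite: MoeglinVignerasWaldspurger1987, Chap. 2 II.1 Rem. (6)] -/
theorem exists_functional_left_of_eigenvector_right (φ : A → localPi L (IsCMField.complexConj L) n J v) (η : A → ℂ)
    {f₂ : SchwartzBruhat (Fin n → v.adicCompletion (maximalRealSubfield L))} (hf0 : f₂ ≠ 0)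
    (hf : ∀ a, MpPsi.toRep (localSchrodinger (maximalRealSubfield L) n (-T₀) v)
      (BlockSum.restrictRight (maximalRealSubfield L) L (IsCMField.complexConj L) v n n hJ'
        (hJD_finSum (maximalRealSubfield L) L n rfl) (complexConj_imagUnit L) (imagUnit_ne_zero L) (imagUnit_mul_self L)
        hT₀ hT₀.neg hT₀d
        ((localSplittingDatumCM L v μ n hT₀ hT₀d rfl χ hχ).localSplitting)
        ((localSplittingDatumCM L v μ n hT₀ hT₀d rfl χ hχ).proj_localSplitting)
        (toNegForm (maximalRealSubfield L) L (IsCMField.complexConj L) v n hJ hJ' (φ a))) f₂ = η a • f₂) :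
    ∃ ℓ : SchwartzBruhat (Fin n → v.adicCompletion (maximalRealSubfield L)) →ₗ[ℂ] ℂ, ℓ ≠ 0 ∧
      (∀ f₁, ℓ f₁ = ((MpPsi.toRep (localSchrodinger (maximalRealSubfield L) (n + n) (gramD (maximalRealSubfield L) n T₀) v) m₀
          (boxSB (v.adicCompletion (maximalRealSubfield L)) (e₂ n) f₁ f₂) :
        SchwartzBruhat (Fin (n + n) → v.adicCompletion (maximalRealSubfield L))) : (Fin (n + n) → v.adicCompletion (maximalRealSubfield L)) → ℂ) 0) ∧
      ∀ (a : A) (f₁ : SchwartzBruhat (Fin n → v.adicCompletion (maximalRealSubfield L))),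
        η a * ℓ (MpPsi.toRep (localSchrodinger (maximalRealSubfield L) n T₀ v)
          (BlockSum.restrictLeft (maximalRealSubfield L) L (IsCMField.complexConj L) v n n hJ
            (hJD_finSum (maximalRealSubfield L) L n rfl) (complexConj_imagUnit L) (imagUnit_ne_zero L) (imagUnit_mul_self L)
            hT₀ hT₀.neg (isUnit_det_neg_of_isUnit (maximalRealSubfield L) n hT₀d)
            ((localSplittingDatumCM L v μ n hT₀ hT₀d rfl χ hχ).localSplitting)
            ((localSplittingDatumCM L v μ n hT₀ hT₀d rfl χ hχ).proj_localSplitting) (φ a)) f₁) =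
        (((chiDet (maximalRealSubfield L) L (IsCMField.complexConj L) v n
            (fun w' : PlacesOver L v => (χ.localComponent w'.1)⁻¹)
            (diagD (maximalRealSubfield L) L (IsCMField.complexConj L) v n hJ hJ' rfl (φ a)))⁻¹ : ℂˣ) : ℂ) *
        ((∏ w' : PlacesOver L v,
            Real.sqrt ‖detDelta (maximalRealSubfield L) L (IsCMField.complexConj L) v n w'
              (diagD (maximalRealSubfield L) L (IsCMField.complexConj L) v n hJ hJ' rfl (φ a))‖ : ℝ) : ℂ) * ℓ f₁ := by
  obtain ⟨lam, hlam⟩ := exists_linearMap_apply_zero_toRep (maximalRealSubfield L) v n m₀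
  let ℓ : SchwartzBruhat (Fin n → v.adicCompletion (maximalRealSubfield L)) →ₗ[ℂ] ℂ :=
    lam ∘ₗ (sumEquivSB (v.adicCompletion (maximalRealSubfield L)) (e₂ n)).toLinearMap ∘ₗ
      (TensorProduct.mk ℂ (SchwartzBruhat (Fin n → v.adicCompletion (maximalRealSubfield L)))
        (SchwartzBruhat (Fin n → v.adicCompletion (maximalRealSubfield L)))).flip f₂
  have hℓ' : ∀ f₁, ℓ f₁ = lam (boxSB (v.adicCompletion (maximalRealSubfield L)) (e₂ n) f₁ f₂) := by
    intro f₁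
    change lam (sumEquivSB (v.adicCompletion (maximalRealSubfield L)) (e₂ n) (f₁ ⊗ₜ f₂)) = _
    rw [sumEquivSB_tmul]
  have hℓ : ∀ f₁, ℓ f₁ = ((MpPsi.toRep (localSchrodinger (maximalRealSubfield L) (n + n) (gramD (maximalRealSubfield L) n T₀) v) m₀
          (boxSB (v.adicCompletion (maximalRealSubfield L)) (e₂ n) f₁ f₂) :
        SchwartzBruhat (Fin (n + n) → v.adicCompletion (maximalRealSubfield L))) : (Fin (n + n) → v.adicCompletion (maximalRealSubfield L)) → ℂ) 0 :=
    fun f₁ => (hℓ' f₁).trans (hlam _)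
  have hsmul : ∀ (c : ℂ) (g : SchwartzBruhat (Fin n → v.adicCompletion (maximalRealSubfield L))),
      boxSB (v.adicCompletion (maximalRealSubfield L)) (e₂ n) g (c • f₂) = c • boxSB (v.adicCompletion (maximalRealSubfield L)) (e₂ n) g f₂ := by
    intro c g
    rw [← sumEquivSB_tmul, TensorProduct.tmul_smul, map_smul, sumEquivSB_tmul]
  refine ⟨ℓ, ?_, hℓ, ?_⟩
  · intro h0
    apply hf0
    refine eq_zero_of_forall_apply_zero_toRep_boxSB_right_eq_zero (maximalRealSubfield L) v n hT₀d m₀ hm₀ f₂ fun f₁ => ?_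
    rw [← hℓ, h0, LinearMap.zero_apply]
  · intro a f₁
    have key := apply_zero_toRep_boxSB_restrict_diagD L v μ n hT₀ hT₀d χ hχ m₀ hm₀ hJ hJ' (φ a) f₁ f₂
    rw [← hlam, ← hlam, hf a, hsmul, map_smul, smul_eq_mul] at key
    rw [hℓ', hℓ']
    exact key

end Functional

/-! ## §2 Coinvariant currency: for a compact `A`, the types of the two blocks are exchanged by `η ↦ (e ∘ φ) · η⁻¹` -/

section Coinv

variable {A : Type*} [Group A] [TopologicalSpace A] [IsTopologicalGroup A] [CompactSpace A]

include hm₀ in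
set_option maxHeartbeats 4000000 in -- the doubled CM datum's telescope (as in ★ `LocalDoubledDiagonalEigenlaw`)
/-- **(D), LEFT ⇒ RIGHT, IN THE COINVARIANT CURRENCY.**  `A` compact, `φ : A →* U(J)(L⁺_v)`, characters `η θ : A →* ℂˣ` with
`η(a)·θ(a) = e(φ a)`, `ker η` open, `ω₁ ∘ s₁ ∘ φ` smooth: if the `η`-coinvariants of the first block are non-zero, so are the
`θ`-coinvariants of the second block (an `η`-eigenvector exists by the compact dictionary ★ `TwistedCoinv.exists_mem_weightSpace_mk_eq`,
§1 gives a non-zero `θ`-quasi-invariant functional, which factors through the `θ`-coinvariants ★ `TwistedCoinv.lift_eq_zero_iff`).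
[cite: Kudla1994, §3 Thm. 3.1] [cite: HarrisKudlaSweet1996, §3] [cite: BernsteinZelevinsky1976, §2.1–2.3] -/
theorem nontrivial_coinv_right_of_nontrivial_coinv_left (φ : A →* localPi L (IsCMField.complexConj L) n J v) (η θ : A →* ℂˣ)
    (hηθ : ∀ a, ((η a : ℂˣ) : ℂ) * ((θ a : ℂˣ) : ℂ) =
      (((chiDet (maximalRealSubfield L) L (IsCMField.complexConj L) v n
            (fun w' : PlacesOver L v => (χ.localComponent w'.1)⁻¹)
            (diagD (maximalRealSubfield L) L (IsCMField.complexConj L) v n hJ hJ' rfl (φ a)))⁻¹ : ℂˣ) : ℂ) *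
        ((∏ w' : PlacesOver L v,
            Real.sqrt ‖detDelta (maximalRealSubfield L) L (IsCMField.complexConj L) v n w'
              (diagD (maximalRealSubfield L) L (IsCMField.complexConj L) v n hJ hJ' rfl (φ a))‖ : ℝ) : ℂ))
    (hη : IsOpen (η.ker : Set A))
    (hsm : Representation.IsSmooth ((((MpPsi.toRep (localSchrodinger (maximalRealSubfield L) n T₀ v)).comp
      (BlockSum.restrictLeft (maximalRealSubfield L) L (IsCMField.complexConj L) v n n hJ
        (hJD_finSum (maximalRealSubfield L) L n rfl) (complexConj_imagUnit L) (imagUnit_ne_zero L) (imagUnit_mul_self L)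
        hT₀ hT₀.neg (isUnit_det_neg_of_isUnit (maximalRealSubfield L) n hT₀d)
        ((localSplittingDatumCM L v μ n hT₀ hT₀d rfl χ hχ).localSplitting)
        ((localSplittingDatumCM L v μ n hT₀ hT₀d rfl χ hχ).proj_localSplitting))).comp φ)))
    (hnt : Nontrivial (TwistedCoinv.Coinv (((MpPsi.toRep (localSchrodinger (maximalRealSubfield L) n T₀ v)).comp
      (BlockSum.restrictLeft (maximalRealSubfield L) L (IsCMField.complexConj L) v n n hJ
        (hJD_finSum (maximalRealSubfield L) L n rfl) (complexConj_imagUnit L) (imagUnit_ne_zero L) (imagUnit_mul_self L)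
        hT₀ hT₀.neg (isUnit_det_neg_of_isUnit (maximalRealSubfield L) n hT₀d)
        ((localSplittingDatumCM L v μ n hT₀ hT₀d rfl χ hχ).localSplitting)
        ((localSplittingDatumCM L v μ n hT₀ hT₀d rfl χ hχ).proj_localSplitting))).comp φ) η)) :
    Nontrivial (TwistedCoinv.Coinv (((MpPsi.toRep (localSchrodinger (maximalRealSubfield L) n (-T₀) v)).comp
      (BlockSum.restrictRight (maximalRealSubfield L) L (IsCMField.complexConj L) v n n hJ'
        (hJD_finSum (maximalRealSubfield L) L n rfl) (complexConj_imagUnit L) (imagUnit_ne_zero L) (imagUnit_mul_self L)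
        hT₀ hT₀.neg hT₀d
        ((localSplittingDatumCM L v μ n hT₀ hT₀d rfl χ hχ).localSplitting)
        ((localSplittingDatumCM L v μ n hT₀ hT₀d rfl χ hχ).proj_localSplitting))).comp
      ((toNegForm (maximalRealSubfield L) L (IsCMField.complexConj L) v n hJ hJ').toMonoidHom.comp φ)) θ) := by
  -- an `η`-eigenvector of the first block
  obtain ⟨x, hx⟩ := @exists_ne _ hnt 0
  obtain ⟨w, rfl⟩ := TwistedCoinv.mk_surjective _ _ x
  obtain ⟨f, hfw, hfx⟩ := TwistedCoinv.exists_mem_weightSpace_mk_eq _ η hsm hη w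
  have hf0 : f ≠ 0 := by
    rintro rfl
    rw [map_zero] at hfx
    exact hx hfx.symm
  rw [Literature.RepresentationTheory.mem_weightSpace] at hfw
  -- §1: the slice functional `λ(f ⊠ ·)`
  obtain ⟨ℓ, hℓ0, -, hℓ⟩ := exists_functional_right_of_eigenvector_left L v μ n hT₀ hT₀d χ hχ m₀ hm₀ hJ hJ' φ
    (fun a => ((η a : ℂˣ) : ℂ)) hf0 (fun a => hfw a)
  -- it is `θ`-quasi-invariant
  have hℓθ : ∀ (a : A) (f₂ : SchwartzBruhat (Fin n → v.adicCompletion (maximalRealSubfield L))),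
      ℓ ((((MpPsi.toRep (localSchrodinger (maximalRealSubfield L) n (-T₀) v)).comp
        (BlockSum.restrictRight (maximalRealSubfield L) L (IsCMField.complexConj L) v n n hJ'
          (hJD_finSum (maximalRealSubfield L) L n rfl) (complexConj_imagUnit L) (imagUnit_ne_zero L) (imagUnit_mul_self L)
          hT₀ hT₀.neg hT₀d
          ((localSplittingDatumCM L v μ n hT₀ hT₀d rfl χ hχ).localSplitting)
          ((localSplittingDatumCM L v μ n hT₀ hT₀d rfl χ hχ).proj_localSplitting))).comp
        ((toNegForm (maximalRealSubfield L) L (IsCMField.complexConj L) v n hJ hJ').toMonoidHom.comp φ)) a f₂) =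
        ((θ a : ℂˣ) : ℂ) • ℓ f₂ := by
    intro a f₂
    have h := hℓ a f₂
    rw [← hηθ a, mul_assoc] at h
    have h' := mul_left_cancel₀ (Units.ne_zero (η a)) h
    rw [smul_eq_mul, ← h']
    rfl
  -- hence the `θ`-coinvariants carry a non-zero functional
  have hlift := (TwistedCoinv.lift_eq_zero_iff _ θ ℓ hℓθ).not.2 hℓ0
  obtain ⟨y, hy⟩ : ∃ y, TwistedCoinv.lift _ θ ℓ hℓθ y ≠ 0 := by
    by_contra hall
    push Not at hall
    exact hlift (LinearMap.ext hall)
  exact nontrivial_of_ne y 0 fun h0 => hy (by rw [h0, map_zero])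

include hm₀ in
set_option maxHeartbeats 4000000 in -- the doubled CM datum's telescope (as in ★ `LocalDoubledDiagonalEigenlaw`)
/-- **(D), RIGHT ⇒ LEFT, IN THE COINVARIANT CURRENCY** (mirror of the previous theorem).
[cite: Kudla1994, §3 Thm. 3.1] [cite: HarrisKudlaSweet1996, §3] [cite: BernsteinZelevinsky1976, §2.1–2.3] -/
theorem nontrivial_coinv_left_of_nontrivial_coinv_right (φ : A →* localPi L (IsCMField.complexConj L) n J v) (η θ : A →* ℂˣ)
    (hηθ : ∀ a, ((η a : ℂˣ) : ℂ) * ((θ a : ℂˣ) : ℂ) =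
      (((chiDet (maximalRealSubfield L) L (IsCMField.complexConj L) v n
            (fun w' : PlacesOver L v => (χ.localComponent w'.1)⁻¹)
            (diagD (maximalRealSubfield L) L (IsCMField.complexConj L) v n hJ hJ' rfl (φ a)))⁻¹ : ℂˣ) : ℂ) *
        ((∏ w' : PlacesOver L v,
            Real.sqrt ‖detDelta (maximalRealSubfield L) L (IsCMField.complexConj L) v n w'
              (diagD (maximalRealSubfield L) L (IsCMField.complexConj L) v n hJ hJ' rfl (φ a))‖ : ℝ) : ℂ))
    (hη : IsOpen (η.ker : Set A))
    (hsm : Representation.IsSmooth ((((MpPsi.toRep (localSchrodinger (maximalRealSubfield L) n (-T₀) v)).comp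
      (BlockSum.restrictRight (maximalRealSubfield L) L (IsCMField.complexConj L) v n n hJ'
        (hJD_finSum (maximalRealSubfield L) L n rfl) (complexConj_imagUnit L) (imagUnit_ne_zero L) (imagUnit_mul_self L)
        hT₀ hT₀.neg hT₀d
        ((localSplittingDatumCM L v μ n hT₀ hT₀d rfl χ hχ).localSplitting)
        ((localSplittingDatumCM L v μ n hT₀ hT₀d rfl χ hχ).proj_localSplitting))).comp
      ((toNegForm (maximalRealSubfield L) L (IsCMField.complexConj L) v n hJ hJ').toMonoidHom.comp φ))))
    (hnt : Nontrivial (TwistedCoinv.Coinv (((MpPsi.toRep (localSchrodinger (maximalRealSubfield L) n (-T₀) v)).comp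
      (BlockSum.restrictRight (maximalRealSubfield L) L (IsCMField.complexConj L) v n n hJ'
        (hJD_finSum (maximalRealSubfield L) L n rfl) (complexConj_imagUnit L) (imagUnit_ne_zero L) (imagUnit_mul_self L)
        hT₀ hT₀.neg hT₀d
        ((localSplittingDatumCM L v μ n hT₀ hT₀d rfl χ hχ).localSplitting)
        ((localSplittingDatumCM L v μ n hT₀ hT₀d rfl χ hχ).proj_localSplitting))).comp
      ((toNegForm (maximalRealSubfield L) L (IsCMField.complexConj L) v n hJ hJ').toMonoidHom.comp φ)) η)) :
    Nontrivial (TwistedCoinv.Coinv (((MpPsi.toRep (localSchrodinger (maximalRealSubfield L) n T₀ v)).comp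
      (BlockSum.restrictLeft (maximalRealSubfield L) L (IsCMField.complexConj L) v n n hJ
        (hJD_finSum (maximalRealSubfield L) L n rfl) (complexConj_imagUnit L) (imagUnit_ne_zero L) (imagUnit_mul_self L)
        hT₀ hT₀.neg (isUnit_det_neg_of_isUnit (maximalRealSubfield L) n hT₀d)
        ((localSplittingDatumCM L v μ n hT₀ hT₀d rfl χ hχ).localSplitting)
        ((localSplittingDatumCM L v μ n hT₀ hT₀d rfl χ hχ).proj_localSplitting))).comp φ) θ) := by
  obtain ⟨x, hx⟩ := @exists_ne _ hnt 0
  obtain ⟨w, rfl⟩ := TwistedCoinv.mk_surjective _ _ x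
  obtain ⟨f₂, hfw, hfx⟩ := TwistedCoinv.exists_mem_weightSpace_mk_eq _ η hsm hη w
  have hf0 : f₂ ≠ 0 := by
    rintro rfl
    rw [map_zero] at hfx
    exact hx hfx.symm
  rw [Literature.RepresentationTheory.mem_weightSpace] at hfw
  obtain ⟨ℓ, hℓ0, -, hℓ⟩ := exists_functional_left_of_eigenvector_right L v μ n hT₀ hT₀d χ hχ m₀ hm₀ hJ hJ' φ
    (fun a => ((η a : ℂˣ) : ℂ)) hf0 (fun a => hfw a)
  have hℓθ : ∀ (a : A) (f₁ : SchwartzBruhat (Fin n → v.adicCompletion (maximalRealSubfield L))),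
      ℓ ((((MpPsi.toRep (localSchrodinger (maximalRealSubfield L) n T₀ v)).comp
        (BlockSum.restrictLeft (maximalRealSubfield L) L (IsCMField.complexConj L) v n n hJ
          (hJD_finSum (maximalRealSubfield L) L n rfl) (complexConj_imagUnit L) (imagUnit_ne_zero L) (imagUnit_mul_self L)
          hT₀ hT₀.neg (isUnit_det_neg_of_isUnit (maximalRealSubfield L) n hT₀d)
          ((localSplittingDatumCM L v μ n hT₀ hT₀d rfl χ hχ).localSplitting)
          ((localSplittingDatumCM L v μ n hT₀ hT₀d rfl χ hχ).proj_localSplitting))).comp φ) a f₁) =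
        ((θ a : ℂˣ) : ℂ) • ℓ f₁ := by
    intro a f₁
    have h := hℓ a f₁
    rw [← hηθ a, mul_assoc] at h
    have h' := mul_left_cancel₀ (Units.ne_zero (η a)) h
    rw [smul_eq_mul, ← h']
    rfl
  have hlift := (TwistedCoinv.lift_eq_zero_iff _ θ ℓ hℓθ).not.2 hℓ0
  obtain ⟨y, hy⟩ : ∃ y, TwistedCoinv.lift _ θ ℓ hℓθ y ≠ 0 := by
    by_contra hall
    push Not at hall
    exact hlift (LinearMap.ext hall)
  exact nontrivial_of_ne y 0 fun h0 => hy (by rw [h0, map_zero])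

end Coinv

end Literature.NumberTheory.GelbartRogawski1991.UnitaryDualPair.LocalSplitting

end
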